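import Summits.Ventures.GridStability.Bench.CHIANG3Deg2ARecertDA8eqbRoa
import Summits.Ventures.GridStability.Lyapunov.AngleRecovery
import Summits.Ventures.GridStability.Models.Chiang3
import Mathlib.Analysis.SpecialFunctions.Trigonometric.Deriv
import Mathlib.Tactic.IntervalCases
import HarnessLib

/-!
# G1.a′ CHIANG3-roa (model half) — no pole slip and return to synchronism FOR model-1's infinite-bus model of
# the Chiang 2011 / Anghel 2013 3-machine cycle (`Chiang3.data.IsInfBusSolutionOn`)

Venture GRIDFUSION, PARTITION A8 (rung G1.a′), A5/A6; seat gridfusion-lyap-1. Sibling of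
`CHIANG3Deg2ARecertDA8eqbRoa.lean` (recast half, p469300), which it imports; uses model-1's
`Models/PolynomialiseInfBus.lean` (`RecastData.embedRel`, `IsInfBusSolutionOn`, `hasDerivWithinAt_embedInf`),
`Models/Chiang3.lean` (`Chiang3.data : RecastData 2`, `Chiang3.field = data.infField`) and
`Lyapunov/AngleRecovery.lean`.

FAITHFULNESS IN THE KERNEL (`deg2_A_recertD_A8eqb_gk_eval_k`): each symbolic component `Chiang3.data.gkInf k` of model-1's
infinite-bus recast NORMALISES (`SOS.Poly.norm`, `decide +kernel`) to the certificate's literal `model.f[k]`, so the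
Bench field IS the push-forward of the machine dynamics along `embedRel`.

THREE COLUMNS. CERTIFIED: the Bench identities (consumed through `deg2_A_recertD_A8eqb_roa`). MODELLED: every theorem here is about
model-1's 2-machine + infinite-bus classical model (`RecastData.IsInfBusSolutionOn δ₀`: bus angle frozen at `δ₀`, bus
speed deviation `0`, machines `1, 2` follow `ClassicalSwing.field` of `Chiang3.data.toModel`; exact data of
`Chiang3.data`, equilibrium angles `δs` with `Chiang3.data.EqData δs` — PARTITION A1′; MODEL-VALIDITY row in the Bench
file). VALIDATED: nothing (the comparison with the printed ROA figures is sos-3's VALIDATED column). No sentence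
here says a grid is stable.

STATEMENT (`deg2_A_recertD_A8eqb_model_roa`): for every `0 < γ ≤ 49/50` and every infinite-bus solution `c` on `[0, ∞)` whose
recast initial state satisfies `V ≤ γ` and `|u₁(0)|, |u₂(0)| < π`: `V ≤ γ` along the recast state for all
`t ≥ 0`; `|u₁(t)|, |u₂(t)| < π` for all `t ≥ 0` (no pole slip); `u₁(t), u₂(t) → 0` and the machine speed
deviations `ω₁(t), ω₂(t) → 0`.
-/

namespace Summit.Ventures.GridStability.Bench.CHIANG3

open Set Filter Metric Topology Real
open Summit.Ventures.GridStability.Lyapunov Summit.Ventures.GridStability.Models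
open Literature.Computation.Certificates Literature.Computation.Certificates.SOS

noncomputable section

/-- The relative recast coordinates of a state (closed form of model-1's `RecastData.embedRel δs x` on the
indices `< 6`): `(sin u₁, 1 − cos u₁, sin u₂, 1 − cos u₂, ω₁ − ω₀, ω₂ − ω₀)`. [folklore] -/
def deg2_A_recertD_A8eqb_Z (δs : Fin 3 → ℝ) (x : ClassicalSwing.State 3) : Fin 6 → ℝ :=
  ![sin (RecastData.u δs x 1), 1 - cos (RecastData.u δs x 1), sin (RecastData.u δs x 2), 1 - cos (RecastData.u δs x 2), x.2 1 - x.2 0, x.2 2 - x.2 0]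

/-- Coordinate `0` of `deg2_A_recertD_A8eqb_Z`. [folklore] -/
@[simp] theorem deg2_A_recertD_A8eqb_Z_0 (δs : Fin 3 → ℝ) (x : ClassicalSwing.State 3) :
    deg2_A_recertD_A8eqb_Z δs x 0 = sin (RecastData.u δs x 1) := rfl
/-- Coordinate `1` of `deg2_A_recertD_A8eqb_Z`. [folklore] -/
@[simp] theorem deg2_A_recertD_A8eqb_Z_1 (δs : Fin 3 → ℝ) (x : ClassicalSwing.State 3) :
    deg2_A_recertD_A8eqb_Z δs x 1 = 1 - cos (RecastData.u δs x 1) := rfl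
/-- Coordinate `2` of `deg2_A_recertD_A8eqb_Z`. [folklore] -/
@[simp] theorem deg2_A_recertD_A8eqb_Z_2 (δs : Fin 3 → ℝ) (x : ClassicalSwing.State 3) :
    deg2_A_recertD_A8eqb_Z δs x 2 = sin (RecastData.u δs x 2) := rfl
/-- Coordinate `3` of `deg2_A_recertD_A8eqb_Z`. [folklore] -/
@[simp] theorem deg2_A_recertD_A8eqb_Z_3 (δs : Fin 3 → ℝ) (x : ClassicalSwing.State 3) :
    deg2_A_recertD_A8eqb_Z δs x 3 = 1 - cos (RecastData.u δs x 2) := rfl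
/-- Coordinate `4` of `deg2_A_recertD_A8eqb_Z`. [folklore] -/
@[simp] theorem deg2_A_recertD_A8eqb_Z_4 (δs : Fin 3 → ℝ) (x : ClassicalSwing.State 3) :
    deg2_A_recertD_A8eqb_Z δs x 4 = x.2 1 - x.2 0 := rfl
/-- Coordinate `5` of `deg2_A_recertD_A8eqb_Z`. [folklore] -/
@[simp] theorem deg2_A_recertD_A8eqb_Z_5 (δs : Fin 3 → ℝ) (x : ClassicalSwing.State 3) :
    deg2_A_recertD_A8eqb_Z δs x 5 = x.2 2 - x.2 0 := rfl
/-- model-1's `embedRel` at index `0`. [folklore] -/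
theorem deg2_A_recertD_A8eqb_embed_0 (δs : Fin 3 → ℝ) (x : ClassicalSwing.State 3) :
    RecastData.embedRel δs x 0 = sin (RecastData.u δs x 1) := by
  rw [RecastData.embedRel_of_lt δs x (by norm_num)]
  simpa using RecastData.embed_σ δs x (0 : Fin 2)
/-- model-1's `embedRel` at index `1`. [folklore] -/
theorem deg2_A_recertD_A8eqb_embed_1 (δs : Fin 3 → ℝ) (x : ClassicalSwing.State 3) :
    RecastData.embedRel δs x 1 = 1 - cos (RecastData.u δs x 1) := by
  rw [RecastData.embedRel_of_lt δs x (by norm_num)]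
  simpa using RecastData.embed_κ δs x (0 : Fin 2)
/-- model-1's `embedRel` at index `2`. [folklore] -/
theorem deg2_A_recertD_A8eqb_embed_2 (δs : Fin 3 → ℝ) (x : ClassicalSwing.State 3) :
    RecastData.embedRel δs x 2 = sin (RecastData.u δs x 2) := by
  rw [RecastData.embedRel_of_lt δs x (by norm_num)]
  simpa using RecastData.embed_σ δs x (1 : Fin 2)
/-- model-1's `embedRel` at index `3`. [folklore] -/
theorem deg2_A_recertD_A8eqb_embed_3 (δs : Fin 3 → ℝ) (x : ClassicalSwing.State 3) :
    RecastData.embedRel δs x 3 = 1 - cos (RecastData.u δs x 2) := by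
  rw [RecastData.embedRel_of_lt δs x (by norm_num)]
  simpa using RecastData.embed_κ δs x (1 : Fin 2)
/-- model-1's `embedRel` at index `4`. [folklore] -/
theorem deg2_A_recertD_A8eqb_embed_4 (δs : Fin 3 → ℝ) (x : ClassicalSwing.State 3) :
    RecastData.embedRel δs x 4 = x.2 1 - x.2 0 := by
  simpa using RecastData.embedRel_mid (n := 2) δs x (k := 4) (by norm_num) (by norm_num)
/-- model-1's `embedRel` at index `5`. [folklore] -/
theorem deg2_A_recertD_A8eqb_embed_5 (δs : Fin 3 → ℝ) (x : ClassicalSwing.State 3) :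
    RecastData.embedRel δs x 5 = x.2 2 - x.2 0 := by
  simpa using RecastData.embedRel_mid (n := 2) δs x (k := 5) (by norm_num) (by norm_num)
/-- **Kernel faithfulness of field component `0`**: `Chiang3.data.gkInf 0` normalises to the certificate's
literal, hence evaluates on `embedRel` to the Bench decl `deg2_A_recertD_A8eqb_f_sigma_1`. [folklore] -/
theorem deg2_A_recertD_A8eqb_gk_eval_0 (δs : Fin 3 → ℝ) (x : ClassicalSwing.State 3) :
    (Chiang3.data.infField.getD 0 []).eval (RecastData.embedRel δs x) =
      deg2_A_recertD_A8eqb_f_sigma_1 (deg2_A_recertD_A8eqb_Z δs x 0) (deg2_A_recertD_A8eqb_Z δs x 1) (deg2_A_recertD_A8eqb_Z δs x 2) (deg2_A_recertD_A8eqb_Z δs x 3) (deg2_A_recertD_A8eqb_Z δs x 4) (deg2_A_recertD_A8eqb_Z δs x 5) := by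
  have hn : Poly.norm (Chiang3.data.gkInf 0) = Poly.norm
      [(([0, 0, 0, 0, 1, 0] : List ℕ), (1 : ℚ)),
      (([0, 1, 0, 0, 1, 0] : List ℕ), (-1 : ℚ))] := by
    decide +kernel
  rw [RecastData.infField_getD, ← Poly.eval_norm, hn, Poly.eval_norm]
  simp only [Poly.eval_cons, Poly.eval_nil, Monomial.eval_eq, Monomial.evalFrom_cons,
    Monomial.evalFrom_nil, Nat.reduceAdd, deg2_A_recertD_A8eqb_embed_1, deg2_A_recertD_A8eqb_embed_4, deg2_A_recertD_A8eqb_Z_1, deg2_A_recertD_A8eqb_Z_4, deg2_A_recertD_A8eqb_f_sigma_1_eq]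
  push_cast
  ring
/-- **Kernel faithfulness of field component `1`**: `Chiang3.data.gkInf 1` normalises to the certificate's
literal, hence evaluates on `embedRel` to the Bench decl `deg2_A_recertD_A8eqb_f_kappa_1`. [folklore] -/
theorem deg2_A_recertD_A8eqb_gk_eval_1 (δs : Fin 3 → ℝ) (x : ClassicalSwing.State 3) :
    (Chiang3.data.infField.getD 1 []).eval (RecastData.embedRel δs x) =
      deg2_A_recertD_A8eqb_f_kappa_1 (deg2_A_recertD_A8eqb_Z δs x 0) (deg2_A_recertD_A8eqb_Z δs x 1) (deg2_A_recertD_A8eqb_Z δs x 2) (deg2_A_recertD_A8eqb_Z δs x 3) (deg2_A_recertD_A8eqb_Z δs x 4) (deg2_A_recertD_A8eqb_Z δs x 5) := by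
  have hn : Poly.norm (Chiang3.data.gkInf 1) = Poly.norm
      [(([1, 0, 0, 0, 1, 0] : List ℕ), (1 : ℚ))] := by
    decide +kernel
  rw [RecastData.infField_getD, ← Poly.eval_norm, hn, Poly.eval_norm]
  simp only [Poly.eval_cons, Poly.eval_nil, Monomial.eval_eq, Monomial.evalFrom_cons,
    Monomial.evalFrom_nil, Nat.reduceAdd, deg2_A_recertD_A8eqb_embed_0, deg2_A_recertD_A8eqb_embed_4, deg2_A_recertD_A8eqb_Z_0, deg2_A_recertD_A8eqb_Z_4, deg2_A_recertD_A8eqb_f_kappa_1_eq]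
  push_cast
  ring
/-- **Kernel faithfulness of field component `2`**: `Chiang3.data.gkInf 2` normalises to the certificate's
literal, hence evaluates on `embedRel` to the Bench decl `deg2_A_recertD_A8eqb_f_sigma_2`. [folklore] -/
theorem deg2_A_recertD_A8eqb_gk_eval_2 (δs : Fin 3 → ℝ) (x : ClassicalSwing.State 3) :
    (Chiang3.data.infField.getD 2 []).eval (RecastData.embedRel δs x) =
      deg2_A_recertD_A8eqb_f_sigma_2 (deg2_A_recertD_A8eqb_Z δs x 0) (deg2_A_recertD_A8eqb_Z δs x 1) (deg2_A_recertD_A8eqb_Z δs x 2) (deg2_A_recertD_A8eqb_Z δs x 3) (deg2_A_recertD_A8eqb_Z δs x 4) (deg2_A_recertD_A8eqb_Z δs x 5) := by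
  have hn : Poly.norm (Chiang3.data.gkInf 2) = Poly.norm
      [(([0, 0, 0, 0, 0, 1] : List ℕ), (1 : ℚ)),
      (([0, 0, 0, 1, 0, 1] : List ℕ), (-1 : ℚ))] := by
    decide +kernel
  rw [RecastData.infField_getD, ← Poly.eval_norm, hn, Poly.eval_norm]
  simp only [Poly.eval_cons, Poly.eval_nil, Monomial.eval_eq, Monomial.evalFrom_cons,
    Monomial.evalFrom_nil, Nat.reduceAdd, deg2_A_recertD_A8eqb_embed_3, deg2_A_recertD_A8eqb_embed_5, deg2_A_recertD_A8eqb_Z_3, deg2_A_recertD_A8eqb_Z_5, deg2_A_recertD_A8eqb_f_sigma_2_eq]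
  push_cast
  ring
/-- **Kernel faithfulness of field component `3`**: `Chiang3.data.gkInf 3` normalises to the certificate's
literal, hence evaluates on `embedRel` to the Bench decl `deg2_A_recertD_A8eqb_f_kappa_2`. [folklore] -/
theorem deg2_A_recertD_A8eqb_gk_eval_3 (δs : Fin 3 → ℝ) (x : ClassicalSwing.State 3) :
    (Chiang3.data.infField.getD 3 []).eval (RecastData.embedRel δs x) =
      deg2_A_recertD_A8eqb_f_kappa_2 (deg2_A_recertD_A8eqb_Z δs x 0) (deg2_A_recertD_A8eqb_Z δs x 1) (deg2_A_recertD_A8eqb_Z δs x 2) (deg2_A_recertD_A8eqb_Z δs x 3) (deg2_A_recertD_A8eqb_Z δs x 4) (deg2_A_recertD_A8eqb_Z δs x 5) := by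
  have hn : Poly.norm (Chiang3.data.gkInf 3) = Poly.norm
      [(([0, 0, 1, 0, 0, 1] : List ℕ), (1 : ℚ))] := by
    decide +kernel
  rw [RecastData.infField_getD, ← Poly.eval_norm, hn, Poly.eval_norm]
  simp only [Poly.eval_cons, Poly.eval_nil, Monomial.eval_eq, Monomial.evalFrom_cons,
    Monomial.evalFrom_nil, Nat.reduceAdd, deg2_A_recertD_A8eqb_embed_2, deg2_A_recertD_A8eqb_embed_5, deg2_A_recertD_A8eqb_Z_2, deg2_A_recertD_A8eqb_Z_5, deg2_A_recertD_A8eqb_f_kappa_2_eq]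
  push_cast
  ring
/-- **Kernel faithfulness of field component `4`**: `Chiang3.data.gkInf 4` normalises to the certificate's
literal, hence evaluates on `embedRel` to the Bench decl `deg2_A_recertD_A8eqb_f_omega_1`. [folklore] -/
theorem deg2_A_recertD_A8eqb_gk_eval_4 (δs : Fin 3 → ℝ) (x : ClassicalSwing.State 3) :
    (Chiang3.data.infField.getD 4 []).eval (RecastData.embedRel δs x) =
      deg2_A_recertD_A8eqb_f_omega_1 (deg2_A_recertD_A8eqb_Z δs x 0) (deg2_A_recertD_A8eqb_Z δs x 1) (deg2_A_recertD_A8eqb_Z δs x 2) (deg2_A_recertD_A8eqb_Z δs x 3) (deg2_A_recertD_A8eqb_Z δs x 4) (deg2_A_recertD_A8eqb_Z δs x 5) := by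
  have hn : Poly.norm (Chiang3.data.gkInf 4) = Poly.norm
      [(([1, 0, 0, 0, 0, 0] : List ℕ), (-177870432865040544719 : ℚ)/118627776749338759202),
      (([0, 1, 0, 0, 0, 0] : List ℕ), (-3532224516 : ℚ)/59313888374669379601),
      (([0, 0, 1, 0, 0, 0] : List ℕ), (59266395447500452849 : ℚ)/118627776749338759202),
      (([0, 0, 0, 1, 0, 0] : List ℕ), (-1186562765221142340 : ℚ)/59313888374669379601),
      (([0, 0, 0, 0, 1, 0] : List ℕ), (-2 : ℚ)/5),
      (([1, 0, 1, 0, 0, 0] : List ℕ), (1186562765221142340 : ℚ)/59313888374669379601),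
      (([1, 0, 0, 1, 0, 0] : List ℕ), (59266395447500452849 : ℚ)/118627776749338759202),
      (([0, 1, 1, 0, 0, 0] : List ℕ), (-59266395447500452849 : ℚ)/118627776749338759202),
      (([0, 1, 0, 1, 0, 0] : List ℕ), (1186562765221142340 : ℚ)/59313888374669379601)] := by
    decide +kernel
  rw [RecastData.infField_getD, ← Poly.eval_norm, hn, Poly.eval_norm]
  simp only [Poly.eval_cons, Poly.eval_nil, Monomial.eval_eq, Monomial.evalFrom_cons,
    Monomial.evalFrom_nil, Nat.reduceAdd, deg2_A_recertD_A8eqb_embed_0, deg2_A_recertD_A8eqb_embed_1, deg2_A_recertD_A8eqb_embed_2, deg2_A_recertD_A8eqb_embed_3, deg2_A_recertD_A8eqb_embed_4, deg2_A_recertD_A8eqb_Z_0, deg2_A_recertD_A8eqb_Z_1, deg2_A_recertD_A8eqb_Z_2, deg2_A_recertD_A8eqb_Z_3, deg2_A_recertD_A8eqb_Z_4, deg2_A_recertD_A8eqb_f_omega_1_eq]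
  push_cast
  ring
/-- **Kernel faithfulness of field component `5`**: `Chiang3.data.gkInf 5` normalises to the certificate's
literal, hence evaluates on `embedRel` to the Bench decl `deg2_A_recertD_A8eqb_f_omega_2`. [folklore] -/
theorem deg2_A_recertD_A8eqb_gk_eval_5 (δs : Fin 3 → ℝ) (x : ClassicalSwing.State 3) :
    (Chiang3.data.infField.getD 5 []).eval (RecastData.embedRel δs x) =
      deg2_A_recertD_A8eqb_f_omega_2 (deg2_A_recertD_A8eqb_Z δs x 0) (deg2_A_recertD_A8eqb_Z δs x 1) (deg2_A_recertD_A8eqb_Z δs x 2) (deg2_A_recertD_A8eqb_Z δs x 3) (deg2_A_recertD_A8eqb_Z δs x 4) (deg2_A_recertD_A8eqb_Z δs x 5) := by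
  have hn : Poly.norm (Chiang3.data.gkInf 5) = Poly.norm
      [(([1, 0, 0, 0, 0, 0] : List ℕ), (59266395447500452849 : ℚ)/118627776749338759202),
      (([0, 1, 0, 0, 0, 0] : List ℕ), (1186562765221142340 : ℚ)/59313888374669379601),
      (([0, 0, 1, 0, 0, 0] : List ℕ), (-59236728410043516672 : ℚ)/59313888374669379601),
      (([0, 0, 0, 1, 0, 0] : List ℕ), (2965694417566285728 : ℚ)/59313888374669379601),
      (([0, 0, 0, 0, 0, 1] : List ℕ), (-1 : ℚ)/2),
      (([1, 0, 1, 0, 0, 0] : List ℕ), (-1186562765221142340 : ℚ)/59313888374669379601),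
      (([1, 0, 0, 1, 0, 0] : List ℕ), (-59266395447500452849 : ℚ)/118627776749338759202),
      (([0, 1, 1, 0, 0, 0] : List ℕ), (59266395447500452849 : ℚ)/118627776749338759202),
      (([0, 1, 0, 1, 0, 0] : List ℕ), (-1186562765221142340 : ℚ)/59313888374669379601)] := by
    decide +kernel
  rw [RecastData.infField_getD, ← Poly.eval_norm, hn, Poly.eval_norm]
  simp only [Poly.eval_cons, Poly.eval_nil, Monomial.eval_eq, Monomial.evalFrom_cons,
    Monomial.evalFrom_nil, Nat.reduceAdd, deg2_A_recertD_A8eqb_embed_0, deg2_A_recertD_A8eqb_embed_1, deg2_A_recertD_A8eqb_embed_2, deg2_A_recertD_A8eqb_embed_3, deg2_A_recertD_A8eqb_embed_5, deg2_A_recertD_A8eqb_Z_0, deg2_A_recertD_A8eqb_Z_1, deg2_A_recertD_A8eqb_Z_2, deg2_A_recertD_A8eqb_Z_3, deg2_A_recertD_A8eqb_Z_5, deg2_A_recertD_A8eqb_f_omega_2_eq]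
  push_cast
  ring

/-- All inertia constants of `Chiang3.data` are nonzero. [folklore] -/
theorem deg2_A_recertD_A8eqb_M_ne_zero : ∀ i, Chiang3.data.M i ≠ 0 := by
  intro i; fin_cases i <;> decide +kernel

/-- **Exact embedding along infinite-bus solutions** (model-1's `hasDerivWithinAt_embedInf` in the Bench
vocabulary): the relative recast curve `t ↦ Z δs (c t)` solves `ż = F(z)` with the Bench field. [folklore] -/
theorem deg2_A_recertD_A8eqb_hasDerivWithinAt_Z {δs : Fin 3 → ℝ} (hEq : Chiang3.data.EqData δs) {δ₀ : ℝ}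
    {c : ℝ → ClassicalSwing.State 3} {s : Set ℝ} (hc : Chiang3.data.IsInfBusSolutionOn δ₀ c s)
    {t : ℝ} (ht : t ∈ s) :
    HasDerivWithinAt (fun τ ↦ deg2_A_recertD_A8eqb_Z δs (c τ)) (deg2_A_recertD_A8eqb_F (deg2_A_recertD_A8eqb_Z δs (c t))) s t := by
  refine hasDerivWithinAt_pi.2 fun k ↦ ?_
  fin_cases k
  · have h := Chiang3.data.hasDerivWithinAt_embedInf hEq deg2_A_recertD_A8eqb_M_ne_zero hc ht 0
    rw [deg2_A_recertD_A8eqb_gk_eval_0] at h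
    simpa [deg2_A_recertD_A8eqb_embed_0] using h
  · have h := Chiang3.data.hasDerivWithinAt_embedInf hEq deg2_A_recertD_A8eqb_M_ne_zero hc ht 1
    rw [deg2_A_recertD_A8eqb_gk_eval_1] at h
    simpa [deg2_A_recertD_A8eqb_embed_1] using h
  · have h := Chiang3.data.hasDerivWithinAt_embedInf hEq deg2_A_recertD_A8eqb_M_ne_zero hc ht 2
    rw [deg2_A_recertD_A8eqb_gk_eval_2] at h
    simpa [deg2_A_recertD_A8eqb_embed_2] using h
  · have h := Chiang3.data.hasDerivWithinAt_embedInf hEq deg2_A_recertD_A8eqb_M_ne_zero hc ht 3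
    rw [deg2_A_recertD_A8eqb_gk_eval_3] at h
    simpa [deg2_A_recertD_A8eqb_embed_3] using h
  · have h := Chiang3.data.hasDerivWithinAt_embedInf hEq deg2_A_recertD_A8eqb_M_ne_zero hc ht 4
    rw [deg2_A_recertD_A8eqb_gk_eval_4] at h
    simpa [deg2_A_recertD_A8eqb_embed_4] using h
  · have h := Chiang3.data.hasDerivWithinAt_embedInf hEq deg2_A_recertD_A8eqb_M_ne_zero hc ht 5
    rw [deg2_A_recertD_A8eqb_gk_eval_5] at h
    simpa [deg2_A_recertD_A8eqb_embed_5] using h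

/-- The relative recast coordinates of any state lie on the constraint set `M`. [folklore] -/
theorem deg2_A_recertD_A8eqb_Z_mem_M (δs : Fin 3 → ℝ) (x : ClassicalSwing.State 3) : deg2_A_recertD_A8eqb_Z δs x ∈ deg2_A_recertD_A8eqb_M := by
  show deg2_A_recertD_A8eqb_h1 (deg2_A_recertD_A8eqb_Z δs x 0) (deg2_A_recertD_A8eqb_Z δs x 1) (deg2_A_recertD_A8eqb_Z δs x 2) (deg2_A_recertD_A8eqb_Z δs x 3) (deg2_A_recertD_A8eqb_Z δs x 4) (deg2_A_recertD_A8eqb_Z δs x 5) = 0 ∧ deg2_A_recertD_A8eqb_h2 (deg2_A_recertD_A8eqb_Z δs x 0) (deg2_A_recertD_A8eqb_Z δs x 1) (deg2_A_recertD_A8eqb_Z δs x 2) (deg2_A_recertD_A8eqb_Z δs x 3) (deg2_A_recertD_A8eqb_Z δs x 4) (deg2_A_recertD_A8eqb_Z δs x 5) = 0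
  refine ⟨?_, ?_⟩
  · simp only [deg2_A_recertD_A8eqb_Z_0, deg2_A_recertD_A8eqb_Z_1, deg2_A_recertD_A8eqb_h1_eq]
    nlinarith [sin_sq_add_cos_sq (RecastData.u δs x 1)]
  · simp only [deg2_A_recertD_A8eqb_Z_2, deg2_A_recertD_A8eqb_Z_3, deg2_A_recertD_A8eqb_h2_eq]
    nlinarith [sin_sq_add_cos_sq (RecastData.u δs x 2)]

/-- **G1.a′-roa in original coordinates (2 machines + infinite bus), with angle recovery (A6).** See the
module docstring for the three columns. [folklore] -/
theorem deg2_A_recertD_A8eqb_model_roa {δs : Fin 3 → ℝ} (hEq : Chiang3.data.EqData δs) {δ₀ : ℝ}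
    {γ : ℝ} (hγ0 : 0 < γ) (hγ : γ ≤ deg2_A_recertD_A8eqb_level)
    {c : ℝ → ClassicalSwing.State 3} (hc : Chiang3.data.IsInfBusSolutionOn δ₀ c (Ici 0))
    (h0V : deg2_A_recertD_A8eqb_Vz (deg2_A_recertD_A8eqb_Z δs (c 0)) ≤ γ)
    (h0win : ∀ i : Fin 2, |RecastData.u δs (c 0) i.succ| < π) :
    (∀ t, 0 ≤ t → deg2_A_recertD_A8eqb_Vz (deg2_A_recertD_A8eqb_Z δs (c t)) ≤ γ) ∧
    (∀ i : Fin 2, ∀ t, 0 ≤ t → |RecastData.u δs (c t) i.succ| < π) ∧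
    (∀ i : Fin 2, Tendsto (fun t ↦ RecastData.u δs (c t) i.succ) atTop (𝓝 0)) ∧
    (∀ i : Fin 2, Tendsto (fun t ↦ (c t).2 i.succ) atTop (𝓝 0)) := by
  -- componentwise continuity of the solution on `[0, ∞)`
  have h1c : ∀ j, ContinuousOn (fun τ ↦ (c τ).1 j) (Ici 0) := by
    intro j t ht
    by_cases hj : j = 0
    · subst hj
      exact (continuousWithinAt_const (b := δ₀)).congr (fun τ hτ ↦ (hc τ hτ).1) (hc t ht).1
    · exact ((hc t ht).2.2 j hj).1.continuousWithinAt
  have h2c : ∀ j, ContinuousOn (fun τ ↦ (c τ).2 j) (Ici 0) := by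
    intro j t ht
    by_cases hj : j = 0
    · subst hj
      exact (continuousWithinAt_const (b := (0 : ℝ))).congr (fun τ hτ ↦ (hc τ hτ).2.1) (hc t ht).2.1
    · exact ((hc t ht).2.2 j hj).2.continuousWithinAt
  have hu : ∀ i : Fin 2, ContinuousOn (fun t ↦ RecastData.u δs (c t) i.succ) (Ici 0) := by
    intro i
    simp only [RecastData.u]
    exact ((h1c _).sub (h1c 0)).sub continuousOn_const
  set z : ℝ → Fin 6 → ℝ := fun τ ↦ deg2_A_recertD_A8eqb_Z δs (c τ) with hzdef
  have hzc : ContinuousOn z (Ici 0) := by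
    refine continuousOn_pi.2 fun k ↦ ?_
    fin_cases k
    · show ContinuousOn (fun t ↦ sin (RecastData.u δs (c t) 1)) (Ici 0)
      exact Real.continuous_sin.comp_continuousOn (hu 0)
    · show ContinuousOn (fun t ↦ 1 - cos (RecastData.u δs (c t) 1)) (Ici 0)
      exact continuousOn_const.sub (Real.continuous_cos.comp_continuousOn (hu 0))
    · show ContinuousOn (fun t ↦ sin (RecastData.u δs (c t) 2)) (Ici 0)
      exact Real.continuous_sin.comp_continuousOn (hu 1)
    · show ContinuousOn (fun t ↦ 1 - cos (RecastData.u δs (c t) 2)) (Ici 0)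
      exact continuousOn_const.sub (Real.continuous_cos.comp_continuousOn (hu 1))
    · show ContinuousOn (fun t ↦ (c t).2 1 - (c t).2 0) (Ici 0)
      exact (h2c 1).sub (h2c 0)
    · show ContinuousOn (fun t ↦ (c t).2 2 - (c t).2 0) (Ici 0)
      exact (h2c 2).sub (h2c 0)
  have hz : ∀ t, 0 ≤ t → HasDerivWithinAt z (deg2_A_recertD_A8eqb_F (z t)) (Ici t) t := fun t ht ↦
    (deg2_A_recertD_A8eqb_hasDerivWithinAt_Z hEq hc ht).mono (Ici_subset_Ici.2 ht)
  obtain ⟨hinv, hlim⟩ := deg2_A_recertD_A8eqb_roa hγ0 hγ hzc hz (deg2_A_recertD_A8eqb_Z_mem_M δs (c 0)) h0V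
  have hall := tendsto_pi_nhds.1 hlim
  -- no pole slip: `κ_i ≤ 3/2 < 2` gives `cos u_i > -1`
  have hcos : ∀ i : Fin 2, ∀ t, 0 ≤ t → -1 < cos (RecastData.u δs (c t) i.succ) := by
    intro i t ht
    obtain ⟨-, hk1, hk2⟩ := hinv t ht
    fin_cases i
    · simp only [hzdef, deg2_A_recertD_A8eqb_Z_1] at hk1
      show -1 < cos (RecastData.u δs (c t) 1)
      linarith
    · simp only [hzdef, deg2_A_recertD_A8eqb_Z_3] at hk2
      show -1 < cos (RecastData.u δs (c t) 2)
      linarith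
  have hwin : ∀ i : Fin 2, ∀ t, 0 ≤ t → |RecastData.u δs (c t) i.succ| < π := fun i ↦
    abs_lt_pi_of_neg_one_lt_cos (hu i) (h0win i) (hcos i)
  refine ⟨fun t ht ↦ (hinv t ht).1, hwin, fun i ↦ ?_, fun i ↦ ?_⟩
  · fin_cases i
    · have h := hall 1
      simp only [hzdef, deg2_A_recertD_A8eqb_Z_1] at h
      exact tendsto_zero_of_one_sub_cos_tendsto (hwin 0) h
    · have h := hall 3
      simp only [hzdef, deg2_A_recertD_A8eqb_Z_3] at h
      exact tendsto_zero_of_one_sub_cos_tendsto (hwin 1) h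
  · -- speeds: `z_(4+i) = ω_(i+1) − ω_0 → 0` and `ω_0 = 0` on `[0, ∞)`
    have hω0 : ∀ᶠ t in atTop, (c t).2 0 = 0 := by
      filter_upwards [eventually_ge_atTop (0 : ℝ)] with t ht using (hc t ht).2.1
    fin_cases i
    · have h := hall 4
      simp only [hzdef, deg2_A_recertD_A8eqb_Z_4] at h
      refine (h.congr' ?_)
      filter_upwards [hω0] with t ht
      show (c t).2 1 - (c t).2 0 = (c t).2 (Fin.succ 0)
      simp [ht]
    · have h := hall 5
      simp only [hzdef, deg2_A_recertD_A8eqb_Z_5] at h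
      refine (h.congr' ?_)
      filter_upwards [hω0] with t ht
      show (c t).2 2 - (c t).2 0 = (c t).2 (Fin.succ 1)
      simp [ht]

end

end Summit.Ventures.GridStability.Bench.CHIANG3
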